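import Summits.NavierStokesRegularity.NavierStokesRegularity.Theorems.EulerZoomLiouvillePowerGaugeEulerLiouvilleBreatherProfile

/-!
# Crux `EulerZoomLiouville.PowerGaugeEulerLiouville` (stmt-NavierStokesRegularity-19832), line `logtime-breathers` (T2/T3):
# the AVERAGED slice pressure of a classical log-time breather and its `D`-growth

Width seat `ns-ezl-w4` (breather rigidity, file V; sequel of `…BreatherProfile`).  For a classical Euler pair `(u, p)` on
`(−∞,0) × ℝ³` with `u(τ, y) = e^{cτ} V(e^{−cτ} y)` the slice pressures `P_τ(z) = (e^{cτ})^{−2} p(τ, e^{cτ} z)` all solve the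
breather profile equation and differ by constants (`BreatherRigidity.slicePressure_sub_eq`), but no single slice is controlled
by the `D`-gauge (a space–time integral).  The AVERAGE `P̄(z) = ∫_{(−2,−1)} P_τ(z) dτ` is again `P_{−1} + const`
(`exists_avgPressure_eq_add_const`), hence solves the profile equation (`profile_equation_avg`), and by the pointwise
power-mean inequality `|∫_I f|^{3/2} ≤ ∫_I |f|^{3/2}` (`|I| = 1`, `enorm_setIntegral_rpow_le`), Tonelli and slice dilation its
`L^{3/2}` growth is controlled by the `D`-gauge WITHOUT loss:
`lintegral_ball_avgPressure_le : ∫_{B_L} |P̄|^{3/2} ≤ e^{12|c|} (e^{2|c|})^{2−2ρ} c₀ · L^{2−2ρ}` for `L ≥ 2`.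

WHAT THIS IS NOT: not NS regularity, not the crux — the pressure brick of the breather-rigidity member; `--supports`
stmt-19832. [folklore]
-/

noncomputable section

set_option linter.dupNamespace false

open MeasureTheory Set Filter Topology Metric Function TopologicalSpace
open scoped ENNReal NNReal RealInnerProductSpace ContDiff

namespace Summit.NavierStokesRegularity.NavierStokesRegularity.Theorems.PowerGaugeEulerLiouville

open Literature.Analysis Literature.Analysis.FunctionSpaces Literature.Analysis.FluidPDE

namespace BreatherRigidity

variable {u : ℝ → EuclideanSpace ℝ (Fin 3) → EuclideanSpace ℝ (Fin 3)} {p : ℝ → EuclideanSpace ℝ (Fin 3) → ℝ}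
  {c : ℝ} {V : EuclideanSpace ℝ (Fin 3) → EuclideanSpace ℝ (Fin 3)}

/-! ### Continuity of the slice-pressure family -/

/-- The slice-pressure family `(τ, z) ↦ (e^{cτ})^{−2} p(τ, e^{cτ} z)` of a classical pair is continuous on `(−∞,0) × ℝ³`. [folklore] -/
theorem continuousOn_slicePressure_uncurry (hcl : IsClassicalEulerSolutionOn (Iio 0) 0 u p) :
    ContinuousOn (fun q : ℝ × EuclideanSpace ℝ (Fin 3) =>
      (Real.exp (c * q.1) ^ 2)⁻¹ * p q.1 (Real.exp (c * q.1) • q.2)) (Iio (0 : ℝ) ×ˢ univ) := by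
  have hp : ContinuousOn (uncurry p) (Iio (0 : ℝ) ×ˢ univ) := hcl.smooth_pressure.continuousOn
  have hmap : Continuous fun q : ℝ × EuclideanSpace ℝ (Fin 3) => (q.1, Real.exp (c * q.1) • q.2) := by fun_prop
  have hmaps : MapsTo (fun q : ℝ × EuclideanSpace ℝ (Fin 3) => (q.1, Real.exp (c * q.1) • q.2))
      (Iio (0 : ℝ) ×ˢ univ) (Iio (0 : ℝ) ×ˢ univ) := fun q hq => ⟨hq.1, mem_univ _⟩
  have h1 : ContinuousOn (fun q : ℝ × EuclideanSpace ℝ (Fin 3) => p q.1 (Real.exp (c * q.1) • q.2))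
      (Iio (0 : ℝ) ×ˢ univ) := hp.comp hmap.continuousOn hmaps
  have h2 : Continuous fun q : ℝ × EuclideanSpace ℝ (Fin 3) => (Real.exp (c * q.1) ^ 2)⁻¹ := by
    refine Continuous.inv₀ (by fun_prop) fun q => ?_
    positivity
  exact h2.continuousOn.mul h1

/-- Continuity of `τ ↦ P_τ(z)` on `(−∞, 0)` at a fixed point `z`. [folklore] -/
theorem continuousOn_slicePressure_time (hcl : IsClassicalEulerSolutionOn (Iio 0) 0 u p) (z : EuclideanSpace ℝ (Fin 3)) :
    ContinuousOn (fun τ : ℝ => (Real.exp (c * τ) ^ 2)⁻¹ * p τ (Real.exp (c * τ) • z)) (Iio 0) := by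
  have h := (continuousOn_slicePressure_uncurry (c := c) hcl).comp
    (Continuous.continuousOn (s := Iio (0 : ℝ)) (by fun_prop : Continuous fun τ : ℝ => (τ, z)))
    (fun τ hτ => ⟨hτ, mem_univ _⟩)
  exact h

/-! ### The averaged slice pressure is a slice pressure up to a constant -/

/-- **`P̄ = P_{−1} + const`.**  The average `P̄(z) = ∫_{(−2,−1)} P_τ(z) dτ` of the slice pressures of a classical breather is
the slice pressure `P_{−1}` plus a constant (each `P_τ − P_{−1}` is the constant `P_τ(0) − P_{−1}(0)`, continuous in `τ`). [folklore] -/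
theorem exists_avgPressure_eq_add_const (hcl : IsClassicalEulerSolutionOn (Iio 0) 0 u p)
    (hbr : ∀ τ : ℝ, τ < 0 → ∀ y, u τ y = Real.exp (c * τ) • V (Real.exp (-(c * τ)) • y)) :
    ∃ k : ℝ, ∀ z : EuclideanSpace ℝ (Fin 3),
      (∫ τ in Ioo (-2 : ℝ) (-1), (Real.exp (c * τ) ^ 2)⁻¹ * p τ (Real.exp (c * τ) • z)) =
        (Real.exp (c * (-1)) ^ 2)⁻¹ * p (-1) (Real.exp (c * (-1)) • z) + k := by
  set kf : ℝ → ℝ := fun τ => (Real.exp (c * τ) ^ 2)⁻¹ * p τ (Real.exp (c * τ) • 0) -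
    (Real.exp (c * (-1)) ^ 2)⁻¹ * p (-1) (Real.exp (c * (-1)) • 0) with hkf
  have hkc : ContinuousOn kf (Icc (-2 : ℝ) (-1)) :=
    ((continuousOn_slicePressure_time (c := c) hcl 0).mono (fun τ hτ => by
      have := hτ.2; rw [mem_Iio]; linarith)).sub continuousOn_const
  have hki : IntegrableOn kf (Ioo (-2 : ℝ) (-1)) volume :=
    (hkc.integrableOn_Icc).mono_set Ioo_subset_Icc_self
  refine ⟨∫ τ in Ioo (-2 : ℝ) (-1), kf τ, fun z => ?_⟩
  have hpt : ∀ τ ∈ Ioo (-2 : ℝ) (-1), (Real.exp (c * τ) ^ 2)⁻¹ * p τ (Real.exp (c * τ) • z) =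
      (Real.exp (c * (-1)) ^ 2)⁻¹ * p (-1) (Real.exp (c * (-1)) • z) + kf τ := by
    intro τ hτ
    have hτ0 : τ < 0 := by have := hτ.2; linarith
    have h := slicePressure_sub_eq hcl hbr hτ0 (by norm_num : (-1 : ℝ) < 0) z
    simp only [hkf]
    linarith
  rw [setIntegral_congr_fun measurableSet_Ioo hpt, integral_add _ hki, setIntegral_const, measureReal_def, Real.volume_Ioo,
    show (-1 : ℝ) - -2 = 1 by ring, ENNReal.toReal_ofReal zero_le_one, one_smul]
  exact (integrableOn_const_iff).2 (Or.inr (by rw [Real.volume_Ioo]; exact ENNReal.ofReal_lt_top))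

/-- The averaged slice pressure is smooth and solves **the breather profile equation**:
`c V − c (z·∇)V + (V·∇)V + ∇P̄ = 0`. [folklore] -/
theorem profile_equation_avg (hcl : IsClassicalEulerSolutionOn (Iio 0) 0 u p)
    (hbr : ∀ τ : ℝ, τ < 0 → ∀ y, u τ y = Real.exp (c * τ) • V (Real.exp (-(c * τ)) • y)) :
    ContDiff ℝ ∞ (fun z : EuclideanSpace ℝ (Fin 3) =>
        ∫ τ in Ioo (-2 : ℝ) (-1), (Real.exp (c * τ) ^ 2)⁻¹ * p τ (Real.exp (c * τ) • z)) ∧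
      ∀ z : EuclideanSpace ℝ (Fin 3), c • V z + (-c) • fderiv ℝ V z z + fderiv ℝ V z (V z) +
        gradient (fun z : EuclideanSpace ℝ (Fin 3) =>
          ∫ τ in Ioo (-2 : ℝ) (-1), (Real.exp (c * τ) ^ 2)⁻¹ * p τ (Real.exp (c * τ) • z)) z = 0 := by
  obtain ⟨k, hk⟩ := exists_avgPressure_eq_add_const hcl hbr
  have hfun : (fun z : EuclideanSpace ℝ (Fin 3) =>
      ∫ τ in Ioo (-2 : ℝ) (-1), (Real.exp (c * τ) ^ 2)⁻¹ * p τ (Real.exp (c * τ) • z)) =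
      fun z => (Real.exp (c * (-1)) ^ 2)⁻¹ * p (-1) (Real.exp (c * (-1)) • z) + k := funext hk
  have h1 : (-1 : ℝ) < 0 := by norm_num
  have hP1 := contDiff_slicePressure (c := c) hcl h1
  rw [hfun]
  refine ⟨hP1.add contDiff_const, fun z => ?_⟩
  have hgrad : gradient (fun z => (Real.exp (c * (-1)) ^ 2)⁻¹ * p (-1) (Real.exp (c * (-1)) • z) + k) z =
      gradient (fun z => (Real.exp (c * (-1)) ^ 2)⁻¹ * p (-1) (Real.exp (c * (-1)) • z)) z := by
    unfold gradient
    rw [fderiv_add_const]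
  rw [hgrad]
  exact profile_equation hcl hbr h1 z

/-! ### The power-mean inequality on a unit interval -/

/-- **Pointwise Jensen / power mean**: for a set `s ⊆ ℝ` of measure `1` and `f : ℝ → ℝ`,
`‖∫_s f‖ₑ^{3/2} ≤ ∫⁻_s ‖f‖ₑ^{3/2}` (Hölder with exponents `3/2, 3` against the constant `1`). [folklore] -/
theorem enorm_setIntegral_rpow_le {s : Set ℝ} (hs : volume s = 1) {f : ℝ → ℝ}
    (hf : AEStronglyMeasurable f (volume.restrict s)) :
    ‖∫ x in s, f x‖ₑ ^ (3 / 2 : ℝ) ≤ ∫⁻ x in s, ‖f x‖ₑ ^ (3 / 2 : ℝ) := by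
  have h1 : ‖∫ x in s, f x‖ₑ ≤ ∫⁻ x in s, ‖f x‖ₑ := enorm_integral_le_lintegral_enorm _
  have hpq : Real.HolderConjugate (3 / 2 : ℝ) 3 := Real.holderConjugate_iff.2 ⟨by norm_num, by norm_num⟩
  have hH := ENNReal.lintegral_mul_le_Lp_mul_Lq (volume.restrict s) hpq hf.enorm
    (aemeasurable_const (b := (1 : ℝ≥0∞)))
  have huniv : (volume.restrict s) univ = 1 := by rw [Measure.restrict_apply_univ, hs]
  simp only [Pi.mul_apply, mul_one, ENNReal.one_rpow, lintegral_const, huniv, mul_one] at hH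
  have h2 : (∫⁻ x in s, ‖f x‖ₑ) ^ (3 / 2 : ℝ) ≤
      ((∫⁻ x in s, ‖f x‖ₑ ^ (3 / 2 : ℝ)) ^ (1 / (3 / 2 : ℝ))) ^ (3 / 2 : ℝ) :=
    ENNReal.rpow_le_rpow hH (by norm_num)
  rw [← ENNReal.rpow_mul, show (1 / (3 / 2 : ℝ)) * (3 / 2) = 1 by norm_num, ENNReal.rpow_one] at h2
  exact (ENNReal.rpow_le_rpow h1 (by norm_num)).trans h2

/-! ### `D`-growth of the averaged slice pressure -/

/-- **THE `D`-GAUGE CONTROLS THE AVERAGED SLICE PRESSURE (large scales, no loss).**  If `(u, p)` is classical on `(−∞,0)`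
and `a^{2ρ} D(a; 0; p) ≤ c₀` for all `a > 0`, then for every `L ≥ 2`
`∫_{B_L} |P̄(z)|^{3/2} dz ≤ e^{12|c|} (e^{2|c|})^{2−2ρ} c₀ · L^{2−2ρ}`, `P̄(z) = ∫_{(−2,−1)} (e^{cτ})^{−2} p(τ, e^{cτ}z) dτ`:
pointwise power mean, Tonelli, on each slice `∫_{B_L}|P_τ|^{3/2} ≤ e^{12|c|}∫_{B_a}|p(τ)|^{3/2}` (`a = e^{2|c|}L`), Tonelli back,
and the window `(−2,−1) × B_a ⊆ Q_a(0,0)`. [folklore] -/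
theorem lintegral_ball_avgPressure_le {ρ : ℝ} {c₀ : ℝ≥0} (hcl : IsClassicalEulerSolutionOn (Iio 0) 0 u p)
    (hD : ∀ a : ℝ, 0 < a →
      ENNReal.ofReal (a ^ (2 * ρ)) * cknD a (0 : ℝ × EuclideanSpace ℝ (Fin 3)) p ≤ (c₀ : ℝ≥0∞))
    {L : ℝ} (hL : 2 ≤ L) :
    ∫⁻ z in ball (0 : EuclideanSpace ℝ (Fin 3)) L,
        ‖∫ τ in Ioo (-2 : ℝ) (-1), (Real.exp (c * τ) ^ 2)⁻¹ * p τ (Real.exp (c * τ) • z)‖ₑ ^ (3 / 2 : ℝ) ≤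
      ENNReal.ofReal (Real.exp (12 * |c|) * Real.exp (2 * |c|) ^ (2 - 2 * ρ)) * (c₀ : ℝ≥0∞) *
        ENNReal.ofReal (L ^ (2 - 2 * ρ)) := by
  have hL0 : 0 < L := by linarith
  have he1 : 1 ≤ Real.exp (2 * |c|) := Real.one_le_exp (by positivity)
  set a : ℝ := Real.exp (2 * |c|) * L with ha
  have haL : L ≤ a := by rw [ha]; nlinarith
  have ha0 : 0 < a := by linarith
  have hcont := continuousOn_slicePressure_uncurry (c := c) hcl
  set Ps : ℝ → EuclideanSpace ℝ (Fin 3) → ℝ := fun τ z => (Real.exp (c * τ) ^ 2)⁻¹ * p τ (Real.exp (c * τ) • z) with hPs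
  -- ### (1) the gauge: `X = ∫∫_{Q_a} |p|^{3/2} ≤ a^{2−2ρ} c₀`
  set X : ℝ≥0∞ := ∫⁻ q in parabolicCylinder a (0 : ℝ × EuclideanSpace ℝ (Fin 3)),
    ‖p q.1 q.2‖ₑ ^ (3 / 2 : ℝ) with hX
  have hXle : X ≤ ENNReal.ofReal (a ^ (2 - 2 * ρ)) * (c₀ : ℝ≥0∞) := by
    have h1 := hD a ha0
    unfold cknD at h1
    have hB0 : ENNReal.ofReal (a ^ (2 * ρ)) ≠ 0 := by
      rw [ENNReal.ofReal_ne_zero_iff]; exact Real.rpow_pos_of_pos ha0 _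
    have hA0 : ENNReal.ofReal a ^ 2 ≠ 0 := pow_ne_zero _ (by rw [ENNReal.ofReal_ne_zero_iff]; exact ha0)
    have hAt : ENNReal.ofReal a ^ 2 ≠ ⊤ := ENNReal.pow_ne_top ENNReal.ofReal_ne_top
    have key : X = ENNReal.ofReal a ^ 2 * (ENNReal.ofReal (a ^ (2 * ρ)))⁻¹ *
        (ENNReal.ofReal (a ^ (2 * ρ)) * ((ENNReal.ofReal a ^ 2)⁻¹ * X)) := by
      rw [← mul_assoc, mul_assoc (ENNReal.ofReal a ^ 2), ENNReal.inv_mul_cancel hB0 ENNReal.ofReal_ne_top,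
        mul_one, ← mul_assoc, ENNReal.mul_inv_cancel hA0 hAt, one_mul]
    calc X = _ := key
      _ ≤ ENNReal.ofReal a ^ 2 * (ENNReal.ofReal (a ^ (2 * ρ)))⁻¹ * (c₀ : ℝ≥0∞) := by gcongr
      _ = ENNReal.ofReal (a ^ (2 - 2 * ρ)) * (c₀ : ℝ≥0∞) := by
          rw [← ENNReal.ofReal_inv_of_pos (Real.rpow_pos_of_pos ha0 _), ← ENNReal.ofReal_pow ha0.le,
            ← ENNReal.ofReal_mul (by positivity)]
          congr 2
          rw [Real.rpow_sub ha0, show a ^ (2 : ℝ) = a ^ (2 : ℕ) by exact_mod_cast Real.rpow_natCast a 2,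
            div_eq_mul_inv]
  -- ### (2) the window `(−2,−1) × B_a ⊆ Q_a(0,0)` and Tonelli for `p`
  have hWsub : Ioo (-2 : ℝ) (-1) ×ˢ ball (0 : EuclideanSpace ℝ (Fin 3)) a ⊆
      parabolicCylinder a (0 : ℝ × EuclideanSpace ℝ (Fin 3)) := by
    intro q hq
    rw [mem_prod, mem_Ioo, mem_ball] at hq
    rw [mem_parabolicCylinder, Prod.fst_zero, Prod.snd_zero, zero_sub]
    have ha2 : (2 : ℝ) ≤ a ^ 2 := by nlinarith
    exact ⟨⟨by linarith [hq.1.1], by linarith [hq.1.2]⟩, hq.2⟩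
  have hsubW : Ioo (-2 : ℝ) (-1) ×ˢ ball (0 : EuclideanSpace ℝ (Fin 3)) a ⊆ Iio (0 : ℝ) ×ˢ univ :=
    prod_mono (fun t ht => by have := ht.2; rw [mem_Iio]; linarith) (subset_univ _)
  have hpmW : AEMeasurable (fun q : ℝ × EuclideanSpace ℝ (Fin 3) => ‖p q.1 q.2‖ₑ ^ (3 / 2 : ℝ))
      (((volume : Measure ℝ).restrict (Ioo (-2 : ℝ) (-1))).prod
        ((volume : Measure (EuclideanSpace ℝ (Fin 3))).restrict (ball 0 a))) := by
    have hpc : ContinuousOn (uncurry p) (Ioo (-2 : ℝ) (-1) ×ˢ ball (0 : EuclideanSpace ℝ (Fin 3)) a) :=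
      hcl.smooth_pressure.continuousOn.mono hsubW
    have h : AEMeasurable (fun q : ℝ × EuclideanSpace ℝ (Fin 3) => ‖uncurry p q‖ₑ ^ (3 / 2 : ℝ))
        (volume.restrict (Ioo (-2 : ℝ) (-1) ×ˢ ball (0 : EuclideanSpace ℝ (Fin 3)) a)) :=
      (hpc.aestronglyMeasurable (measurableSet_Ioo.prod measurableSet_ball)).enorm.pow_const (3 / 2 : ℝ)
    rw [Measure.volume_eq_prod, ← Measure.prod_restrict] at h
    exact h
  have hYeq : ∫⁻ q in Ioo (-2 : ℝ) (-1) ×ˢ ball (0 : EuclideanSpace ℝ (Fin 3)) a, ‖p q.1 q.2‖ₑ ^ (3 / 2 : ℝ) =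
      ∫⁻ τ in Ioo (-2 : ℝ) (-1), ∫⁻ x in ball (0 : EuclideanSpace ℝ (Fin 3)) a, ‖p τ x‖ₑ ^ (3 / 2 : ℝ) := by
    rw [Measure.volume_eq_prod, ← Measure.prod_restrict, lintegral_prod _ hpmW]
  have hY : ∫⁻ τ in Ioo (-2 : ℝ) (-1), ∫⁻ x in ball (0 : EuclideanSpace ℝ (Fin 3)) a, ‖p τ x‖ₑ ^ (3 / 2 : ℝ) ≤ X := by
    rw [← hYeq]; exact lintegral_mono_set hWsub
  -- ### (3) pointwise power mean and Tonelli for the slice-pressure family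
  have hvolI : volume (Ioo (-2 : ℝ) (-1)) = 1 := by
    rw [Real.volume_Ioo, show (-1 : ℝ) - -2 = 1 by ring, ENNReal.ofReal_one]
  have hJ : ∀ z : EuclideanSpace ℝ (Fin 3), ‖∫ τ in Ioo (-2 : ℝ) (-1), Ps τ z‖ₑ ^ (3 / 2 : ℝ) ≤
      ∫⁻ τ in Ioo (-2 : ℝ) (-1), ‖Ps τ z‖ₑ ^ (3 / 2 : ℝ) := by
    intro z
    refine enorm_setIntegral_rpow_le hvolI ?_
    exact ((continuousOn_slicePressure_time (c := c) hcl z).mono (fun t ht => by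
      have := ht.2; rw [mem_Iio]; linarith)).aestronglyMeasurable measurableSet_Ioo
  have hPsm : AEMeasurable (uncurry fun (z : EuclideanSpace ℝ (Fin 3)) (τ : ℝ) => ‖Ps τ z‖ₑ ^ (3 / 2 : ℝ))
      (((volume : Measure (EuclideanSpace ℝ (Fin 3))).restrict (ball 0 L)).prod
        ((volume : Measure ℝ).restrict (Ioo (-2 : ℝ) (-1)))) := by
    have hsw : Continuous fun w : EuclideanSpace ℝ (Fin 3) × ℝ => ((w.2, w.1) : ℝ × EuclideanSpace ℝ (Fin 3)) := by fun_prop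
    have hF : ContinuousOn (fun w : EuclideanSpace ℝ (Fin 3) × ℝ => Ps w.2 w.1)
        (ball (0 : EuclideanSpace ℝ (Fin 3)) L ×ˢ Ioo (-2 : ℝ) (-1)) :=
      hcont.comp hsw.continuousOn (fun w hw => ⟨by have := hw.2.2; rw [mem_Iio]; linarith, mem_univ _⟩)
    have h : AEMeasurable (fun w : EuclideanSpace ℝ (Fin 3) × ℝ => ‖Ps w.2 w.1‖ₑ ^ (3 / 2 : ℝ))
        (volume.restrict (ball (0 : EuclideanSpace ℝ (Fin 3)) L ×ˢ Ioo (-2 : ℝ) (-1))) :=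
      (hF.aestronglyMeasurable (measurableSet_ball.prod measurableSet_Ioo)).enorm.pow_const (3 / 2 : ℝ)
    rw [Measure.volume_eq_prod, ← Measure.prod_restrict] at h
    exact h
  have hswap : ∫⁻ z in ball (0 : EuclideanSpace ℝ (Fin 3)) L, ∫⁻ τ in Ioo (-2 : ℝ) (-1), ‖Ps τ z‖ₑ ^ (3 / 2 : ℝ) =
      ∫⁻ τ in Ioo (-2 : ℝ) (-1), ∫⁻ z in ball (0 : EuclideanSpace ℝ (Fin 3)) L, ‖Ps τ z‖ₑ ^ (3 / 2 : ℝ) :=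
    lintegral_lintegral_swap hPsm
  -- ### (4) the slices: `∫_{B_L}|P_τ|^{3/2} ≤ e^{12|c|} ∫_{B_a}|p(τ)|^{3/2}` for `τ ∈ (−2,−1)`
  have hslice : ∀ τ ∈ Ioo (-2 : ℝ) (-1), ∫⁻ z in ball (0 : EuclideanSpace ℝ (Fin 3)) L, ‖Ps τ z‖ₑ ^ (3 / 2 : ℝ) ≤
      ENNReal.ofReal (Real.exp (12 * |c|)) * ∫⁻ x in ball (0 : EuclideanSpace ℝ (Fin 3)) a, ‖p τ x‖ₑ ^ (3 / 2 : ℝ) := by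
    intro τ hτ
    have hcτ : |c * τ| ≤ 2 * |c| := by
      rw [abs_mul]
      have : |τ| ≤ 2 := by rw [abs_le]; constructor <;> linarith [hτ.1, hτ.2]
      nlinarith [abs_nonneg c]
    set E : ℝ := Real.exp (c * τ) with hE
    have hE0 : 0 < E := Real.exp_pos _
    -- the amplitude factor
    have hamp : ‖(E ^ 2)⁻¹‖ₑ ^ (3 / 2 : ℝ) ≤ ENNReal.ofReal (Real.exp (6 * |c|)) := by
      have h1 : (E ^ 2)⁻¹ ≤ Real.exp (4 * |c|) := by
        rw [hE, ← Real.exp_nat_mul, ← Real.exp_neg, Real.exp_le_exp]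
        push_cast
        linarith [neg_abs_le (c * τ)]
      have h2 : ‖(E ^ 2)⁻¹‖ₑ ≤ ENNReal.ofReal (Real.exp (4 * |c|)) := by
        rw [Real.enorm_eq_ofReal (by positivity)]
        exact ENNReal.ofReal_le_ofReal h1
      calc ‖(E ^ 2)⁻¹‖ₑ ^ (3 / 2 : ℝ) ≤ ENNReal.ofReal (Real.exp (4 * |c|)) ^ (3 / 2 : ℝ) :=
            ENNReal.rpow_le_rpow h2 (by norm_num)
        _ = ENNReal.ofReal (Real.exp (6 * |c|)) := by
            rw [ENNReal.ofReal_rpow_of_pos (Real.exp_pos _), ← Real.exp_mul]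
            ring_nf
    -- pointwise
    have hpt : ∀ z, ‖Ps τ z‖ₑ ^ (3 / 2 : ℝ) ≤
        ENNReal.ofReal (Real.exp (6 * |c|)) * ‖p τ (E • z)‖ₑ ^ (3 / 2 : ℝ) := by
      intro z
      simp only [hPs]
      rw [enorm_mul, ENNReal.mul_rpow_of_nonneg _ _ (by norm_num : (0 : ℝ) ≤ 3 / 2)]
      exact mul_le_mul' hamp le_rfl
    -- the dilation `z ↦ E z`
    have hdil : ∫⁻ z in ball (0 : EuclideanSpace ℝ (Fin 3)) L, ‖p τ (E • z)‖ₑ ^ (3 / 2 : ℝ) ≤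
        ENNReal.ofReal (Real.exp (6 * |c|)) * ∫⁻ x in ball (0 : EuclideanSpace ℝ (Fin 3)) a, ‖p τ x‖ₑ ^ (3 / 2 : ℝ) := by
      rw [lintegral_ball_comp_smul (fun x => ‖p τ x‖ₑ ^ (3 / 2 : ℝ)) hE0 L]
      have h1 : (E ^ 3)⁻¹ ≤ Real.exp (6 * |c|) := by
        rw [hE, ← Real.exp_nat_mul, ← Real.exp_neg, Real.exp_le_exp]
        push_cast
        linarith [neg_abs_le (c * τ)]
      have h2 : E * L ≤ a := by
        have : E ≤ Real.exp (2 * |c|) := by rw [hE, Real.exp_le_exp]; linarith [le_abs_self (c * τ)]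
        rw [ha]; nlinarith
      exact mul_le_mul' (ENNReal.ofReal_le_ofReal h1) (lintegral_mono_set (ball_subset_ball h2))
    calc ∫⁻ z in ball (0 : EuclideanSpace ℝ (Fin 3)) L, ‖Ps τ z‖ₑ ^ (3 / 2 : ℝ)
        ≤ ∫⁻ z in ball (0 : EuclideanSpace ℝ (Fin 3)) L,
            ENNReal.ofReal (Real.exp (6 * |c|)) * ‖p τ (E • z)‖ₑ ^ (3 / 2 : ℝ) := lintegral_mono fun z => hpt z
      _ = ENNReal.ofReal (Real.exp (6 * |c|)) *
            ∫⁻ z in ball (0 : EuclideanSpace ℝ (Fin 3)) L, ‖p τ (E • z)‖ₑ ^ (3 / 2 : ℝ) :=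
          lintegral_const_mul' _ _ ENNReal.ofReal_ne_top
      _ ≤ ENNReal.ofReal (Real.exp (6 * |c|)) * (ENNReal.ofReal (Real.exp (6 * |c|)) *
            ∫⁻ x in ball (0 : EuclideanSpace ℝ (Fin 3)) a, ‖p τ x‖ₑ ^ (3 / 2 : ℝ)) := mul_le_mul' le_rfl hdil
      _ = ENNReal.ofReal (Real.exp (12 * |c|)) * ∫⁻ x in ball (0 : EuclideanSpace ℝ (Fin 3)) a, ‖p τ x‖ₑ ^ (3 / 2 : ℝ) := by
          rw [← mul_assoc, ← ENNReal.ofReal_mul (Real.exp_pos _).le, ← Real.exp_add]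
          ring_nf
  -- ### (5) assemble
  have haρ : a ^ (2 - 2 * ρ) = Real.exp (2 * |c|) ^ (2 - 2 * ρ) * L ^ (2 - 2 * ρ) := by
    rw [ha, Real.mul_rpow (Real.exp_pos _).le hL0.le]
  calc ∫⁻ z in ball (0 : EuclideanSpace ℝ (Fin 3)) L, ‖∫ τ in Ioo (-2 : ℝ) (-1), Ps τ z‖ₑ ^ (3 / 2 : ℝ)
      ≤ ∫⁻ z in ball (0 : EuclideanSpace ℝ (Fin 3)) L, ∫⁻ τ in Ioo (-2 : ℝ) (-1), ‖Ps τ z‖ₑ ^ (3 / 2 : ℝ) :=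
        lintegral_mono fun z => hJ z
    _ = ∫⁻ τ in Ioo (-2 : ℝ) (-1), ∫⁻ z in ball (0 : EuclideanSpace ℝ (Fin 3)) L, ‖Ps τ z‖ₑ ^ (3 / 2 : ℝ) := hswap
    _ ≤ ∫⁻ τ in Ioo (-2 : ℝ) (-1), ENNReal.ofReal (Real.exp (12 * |c|)) *
          ∫⁻ x in ball (0 : EuclideanSpace ℝ (Fin 3)) a, ‖p τ x‖ₑ ^ (3 / 2 : ℝ) :=
        setLIntegral_mono_ae' measurableSet_Ioo ?_  -- placeholder
    _ = ENNReal.ofReal (Real.exp (12 * |c|)) *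
          ∫⁻ τ in Ioo (-2 : ℝ) (-1), ∫⁻ x in ball (0 : EuclideanSpace ℝ (Fin 3)) a, ‖p τ x‖ₑ ^ (3 / 2 : ℝ) :=
        lintegral_const_mul' _ _ ENNReal.ofReal_ne_top
    _ ≤ ENNReal.ofReal (Real.exp (12 * |c|)) * X := mul_le_mul' le_rfl hY
    _ ≤ ENNReal.ofReal (Real.exp (12 * |c|)) * (ENNReal.ofReal (a ^ (2 - 2 * ρ)) * (c₀ : ℝ≥0∞)) := mul_le_mul' le_rfl hXle
    _ = ENNReal.ofReal (Real.exp (12 * |c|) * Real.exp (2 * |c|) ^ (2 - 2 * ρ)) * (c₀ : ℝ≥0∞) *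
          ENNReal.ofReal (L ^ (2 - 2 * ρ)) := by
        rw [haρ, ENNReal.ofReal_mul (by positivity), ENNReal.ofReal_mul (by positivity)]
        ring
  exact Eventually.of_forall fun τ hτ => hslice τ hτ

end BreatherRigidity

end Summit.NavierStokesRegularity.NavierStokesRegularity.Theorems.PowerGaugeEulerLiouville

end
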